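import Mathlib
import Summits.NavierStokesRegularity.NavierStokesRegularity.Theses.StretchingWellBinding
import Summits.NavierStokesRegularity.NavierStokesRegularity.Theorems.StretchingWellBindingBindingCriterionSlab
import Summits.NavierStokesRegularity.NavierStokesRegularity.Theorems.StretchingWellBindingDssProfileBindingTestFields
import Summits.NavierStokesRegularity.NavierStokesRegularity.Theorems.TypeICertificateLadderRungReynoldsOneH1Rate
import Summits.NavierStokesRegularity.NavierStokesRegularity.Theorems.TypeICertificateLadderRungReynoldsOneTaoCover
import Literature.Analysis.FluidPDE.SerrinEnstrophyGronwall
import Literature.Analysis.FluidPDE.TaoEnstrophyLocalisationProofs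
import HarnessLib

/-!
# Route StretchingWellBinding — support item `BindingCriterion` PROVED
  (stmt-NavierStokesRegularity-1577, the route's Λ-lemma; file 3/3)

**Theorem (`stretchingWellBinding_bindingCriterion_proof`, card B1 of the route).** Let `(u, p)` be a
classical solution of unforced Navier–Stokes (`ν > 0`) on `ℝ³ × [0, T)`, Leray–Hopf from its rapidly
decaying datum. If `Λ : ℝ → ℝ` is an ADMISSIBLE RATE — for every `t ∈ [0, T)` and every smooth
compactly supported vector test field `ψ`,
`∫ α₊(t)|ψ|² − ν ∫|∇ψ|²_F ≤ Λ(t) ∫|ψ|²`, `α = ⟪ξ, ∇u ξ⟫`, `ξ = ω/|ω|`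
(i.e. `Λ(t)` dominates the ground-state energy of the stretching Schrödinger operator
`νΔ + α₊(t)`) — and `Λ` is integrable on `[0, T)`, then `u` extends classically past `T`.

Proof. On every closed sub-slab `[0, T']`, `T' < T`, the solution is in Tao's class
(`RungReynoldsOne.stub_taoCover`) and the vorticity enstrophy `Z(t) = ∫|ω(t)|²` obeys the balance
`Z(b) = Z(0) + ∫₀ᵇ 2(∫⟪ω, ∇u ω⟫ − ν∫|∇ω|²_F)` (`DssBinding.vorticity_balance`); truncating `ω(t)` by
the standard cut-offs in the admissible-rate hypothesis (`DssBinding.tendsto_rayleigh_cutoff`) and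
`⟪ω, ∇u ω⟫ ≤ α₊|ω|²` give `∫⟪ω, ∇u ω⟫ − ν∫|∇ω|²_F ≤ Λ(t) Z(t)`
(`stretching_sub_dissipation_le_of_admissibleRate`), hence `Z(b) ≤ Z(0) + ∫₀ᵇ 2Λ⁺ Z` and, by
Grönwall's lemma with the `L¹` kernel `2Λ⁺` (`lintegral_gronwall_le`, RRS 2016 Lemma A.25),
`Z(t) ≤ Z(0) exp(2∫₀ᵀ Λ⁺)` uniformly on `[0, T)` (`enstrophy_le_of_admissibleRate`). With the energy
inequality and `‖∇u‖₂ ≤ ‖ω‖₂` (`lintegral_frobeniusNormSq_fderiv_le_lintegral_sq_norm_curl`) the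
`H¹` norm stays bounded, contradicting Leray's `H¹` blow-up rate `cν³ ≤ ‖u(t)‖⁴_{H¹}(T − t)` at a
singular time (`RungReynoldsOne.stub_h1BlowupRate`, Tao's smooth `H¹` local theory).

HONEST FRAMING: a continuation criterion about a HYPOTHETICAL solution; nothing here bears on the
regularity question itself. Lands `--workitem stmt-NavierStokesRegularity-1577` (typer seat g19 of cell
pub-ns-dss, idle-row item).
-/

noncomputable section

set_option linter.dupNamespace false

namespace Summit.NavierStokesRegularity.NavierStokesRegularity.Theorems

open MeasureTheory Set Filter Topology Module Metric InnerProductSpace Function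
open scoped RealInnerProductSpace Laplacian ContDiff ENNReal NNReal
open Literature.Analysis Literature.Analysis.FluidPDE
open Summit.NavierStokesRegularity.NavierStokesRegularity.Theorems.SimilarityEnstrophy
open Summit.NavierStokesRegularity.NavierStokesRegularity.Theorems.RungReynoldsOne

namespace DssBinding

/-! ### The admissible-rate hypothesis on a slice: `∫⟪ω, Du ω⟫ − ν∫|∇ω|²_F ≤ λ ∫|ω|²` -/

/-- **An admissible rate bounds stretching minus dissipation of the vorticity slice.** For a smooth
slice `w` with `‖Dw‖ ≤ B₁` and `|ω|², |∇ω|²_F, ⟪ω, Dw ω⟫ ∈ L¹` (`ω = curl w`): if every smooth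
compactly supported `ψ` has `∫ α₊|ψ|² − ν∫|∇ψ|²_F ≤ λ ∫|ψ|²` (`α = ⟪ξ, Dw ξ⟫`, `ξ = ω/|ω|`), then
`∫⟪ω, Dw ω⟫ − ν ∫|∇ω|²_F ≤ λ ∫|ω|²` (truncate `ω` by the standard cut-offs, pass to the limit with
`tendsto_rayleigh_cutoff` for the weights `α₊`, `0`, `1`, and use `⟪ω, Dw ω⟫ ≤ α₊|ω|²`). [folklore] -/
theorem stretching_sub_dissipation_le_of_admissibleRate
    {w : EuclideanSpace ℝ (Fin 3) → EuclideanSpace ℝ (Fin 3)} (hw : ContDiff ℝ ∞ w) {ν lam B₁ : ℝ}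
    (h1 : ∀ x, ‖fderiv ℝ w x‖ ≤ B₁)
    (iZ : Integrable fun x => ‖curl w x‖ ^ 2)
    (iF : Integrable fun x => frobeniusNormSq (fderiv ℝ (curl w) x))
    (iS : Integrable fun x => ⟪curl w x, fderiv ℝ w x (curl w x)⟫)
    (hadm : ∀ ψ : EuclideanSpace ℝ (Fin 3) → EuclideanSpace ℝ (Fin 3), ContDiff ℝ (⊤ : ℕ∞) ψ →
      HasCompactSupport ψ →
      (∫ x, max 0 (inner ℝ (vorticityDirection (curl w) x)
          ((fderiv ℝ w x) (vorticityDirection (curl w) x))) * ‖ψ x‖ ^ 2)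
        - ν * (∫ x, frobeniusNormSq (fderiv ℝ ψ x)) ≤ lam * ∫ x, ‖ψ x‖ ^ 2) :
    (∫ x, ⟪curl w x, fderiv ℝ w x (curl w x)⟫) - ν * (∫ x, frobeniusNormSq (fderiv ℝ (curl w) x)) ≤
      lam * ∫ x, ‖curl w x‖ ^ 2 := by
  have hω : ContDiff ℝ ∞ (curl w) := contDiff_curl_smooth hw
  set a : EuclideanSpace ℝ (Fin 3) → ℝ := fun x =>
    max 0 ⟪vorticityDirection (curl w) x, fderiv ℝ w x (vorticityDirection (curl w) x)⟫ with hadef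
  have ha : Measurable a := measurable_posPart_stretchingRate (hw.of_le (by norm_cast)) hω.continuous
  have hB₁ : 0 ≤ B₁ := (norm_nonneg _).trans (h1 0)
  have haA : ∀ x, |a x| ≤ B₁ := by
    intro x
    have hb := abs_inner_vorticityDirection_clm_apply_le (curl w) (fderiv ℝ w x) x
    rw [hadef, abs_of_nonneg (le_max_left _ _), max_le_iff]
    exact ⟨hB₁, ((le_abs_self _).trans hb).trans (h1 x)⟩
  -- the three truncation limits
  set χ : ℕ → EuclideanSpace ℝ (Fin 3) → ℝ := fun n => cutoff ((n : ℝ) + 1) with hχ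
  set An : ℕ → ℝ := fun n => ∫ x, a x * ‖χ n x • curl w x‖ ^ 2 with hAn
  set Fn : ℕ → ℝ := fun n => ∫ x, frobeniusNormSq (fderiv ℝ (fun y => χ n y • curl w y) x) with hFn
  set Mn : ℕ → ℝ := fun n => ∫ x, ‖χ n x • curl w x‖ ^ 2 with hMn
  set A : ℝ := ∫ x, a x * ‖curl w x‖ ^ 2 with hA
  set F : ℝ := ∫ x, frobeniusNormSq (fderiv ℝ (curl w) x) with hF
  set M : ℝ := ∫ x, ‖curl w x‖ ^ 2 with hM
  have hAF : Tendsto (fun n => An n - Fn n) atTop (𝓝 (A - F)) :=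
    tendsto_rayleigh_cutoff hω iZ iF ha haA
  have h0F : Tendsto (fun n => (0 : ℝ) - Fn n) atTop (𝓝 (0 - F)) := by
    have h := tendsto_rayleigh_cutoff hω iZ iF (a := fun _ => (0 : ℝ)) measurable_const
      (A := B₁) (fun _ => by rw [abs_zero]; exact hB₁)
    simpa only [zero_mul, integral_zero] using h
  have h1F : Tendsto (fun n => Mn n - Fn n) atTop (𝓝 (M - F)) := by
    have h := tendsto_rayleigh_cutoff hω iZ iF (a := fun _ => (1 : ℝ)) measurable_const
      (A := 1) (fun _ => by rw [abs_one])
    simpa only [one_mul] using h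
  have hFl : Tendsto Fn atTop (𝓝 F) := by
    have h := h0F.neg
    simpa only [zero_sub, neg_neg] using h
  have hAl : Tendsto An atTop (𝓝 A) := by
    have h := hAF.add hFl
    simpa only [sub_add_cancel] using h
  have hMl : Tendsto Mn atTop (𝓝 M) := by
    have h := h1F.add hFl
    simpa only [sub_add_cancel] using h
  -- the hypothesis along the truncations and its limit
  have hn : ∀ n, An n - ν * Fn n ≤ lam * Mn n := fun n =>
    hadm _ ((contDiff_cutoff _).smul hω) ((hasCompactSupport_cutoff (by positivity)).smul_right)
  have hlim : A - ν * F ≤ lam * M :=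
    le_of_tendsto_of_tendsto' (hAl.sub (hFl.const_mul ν)) (hMl.const_mul lam) hn
  -- `∫⟪ω, Dw ω⟫ ≤ A`
  have iA : Integrable fun x => a x * ‖curl w x‖ ^ 2 :=
    iZ.bdd_mul ha.aestronglyMeasurable (Eventually.of_forall fun x => by
      rw [Real.norm_eq_abs]; exact haA x)
  have hmono : ∫ x, ⟪curl w x, fderiv ℝ w x (curl w x)⟫ ≤ A :=
    integral_mono iS iA fun x => inner_clm_apply_self_le_posPart_mul (curl w) (fderiv ℝ w x) x
  linarith

/-! ### The uniform enstrophy bound from an integrable admissible rate -/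

/-- **Grönwall for the vorticity enstrophy under an admissible integrable rate.** In the Fefferman
class on `[0, T)` (classical, Leray–Hopf from a rapidly decaying datum), an admissible rate `Λ`
integrable on `[0, T)` gives `∫|ω(t)|² ≤ (∫|ω(0)|²) exp(2 ∫_{[0,T)} Λ⁺)` for every `t ∈ [0, T)`
(on each closed sub-slab `[0, T']`: Tao class by `stub_taoCover`, balance `vorticity_balance`,
slice inequality `stretching_sub_dissipation_le_of_admissibleRate`, and `lintegral_gronwall_le`).
[folklore] -/
theorem enstrophy_le_of_admissibleRate {ν T : ℝ} (hν : 0 < ν) (hT : 0 < T)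
    {u : ℝ → EuclideanSpace ℝ (Fin 3) → EuclideanSpace ℝ (Fin 3)}
    {p : ℝ → EuclideanSpace ℝ (Fin 3) → ℝ}
    (hsol : IsClassicalNSSolutionOn (Ico 0 T) ν 0 u p) (hLH : IsLerayHopfOn T ν 0 (u 0) u)
    (hdec : HasRapidSpatialDecay (u 0)) {Λ : ℝ → ℝ}
    (hadm : ∀ t ∈ Ico 0 T, ∀ ψ : EuclideanSpace ℝ (Fin 3) → EuclideanSpace ℝ (Fin 3),
      ContDiff ℝ (⊤ : ℕ∞) ψ → HasCompactSupport ψ →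
      (∫ x, max 0 (inner ℝ (vorticityDirection (curl (u t)) x)
          ((fderiv ℝ (u t) x) (vorticityDirection (curl (u t)) x))) * ‖ψ x‖ ^ 2)
        - ν * (∫ x, frobeniusNormSq (fderiv ℝ ψ x)) ≤ Λ t * ∫ x, ‖ψ x‖ ^ 2)
    (hΛ : IntegrableOn Λ (Ico 0 T)) {t : ℝ} (ht : t ∈ Ico 0 T) :
    ∫ x, ‖curl (u t) x‖ ^ 2 ≤
      (∫ x, ‖curl (u 0) x‖ ^ 2) * Real.exp (2 * ∫ s in Ico 0 T, max (Λ s) 0) := by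
  -- the closed sub-slab `[0, T']`, `T' = (t + T)/2`
  set T' : ℝ := (t + T) / 2 with hT'def
  have hT'0 : 0 < T' := by rw [hT'def]; linarith [ht.1]
  have hT'T : T' < T := by rw [hT'def]; linarith [ht.2]
  have htT' : t ≤ T' := by rw [hT'def]; linarith [ht.2]
  obtain ⟨q, hsolc, hB, hBt, -⟩ := stub_taoCover hν hT hsol hLH hdec ⟨hT'0, hT'T⟩
  obtain ⟨hZcont, hΦint, hZeq⟩ := vorticity_balance hT'0 hsolc hB hBt
  -- notation
  set Z : ℝ → ℝ := fun s => ∫ x, ‖curl (u s) x‖ ^ 2 with hZdef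
  set Φ : ℝ → ℝ := fun s => 2 * ((∫ x, ⟪curl (u s) x, fderiv ℝ (u s) x (curl (u s) x)⟫)
    - ν * ∫ x, frobeniusNormSq (fderiv ℝ (curl (u s)) x)) with hΦdef
  set Λp : ℝ → ℝ := fun s => max (Λ s) 0 with hΛpdef
  have hΛp0 : ∀ s, 0 ≤ Λp s := fun s => le_max_right _ _
  have hΛpint : IntegrableOn Λp (Ico 0 T) := hΛ.pos_part
  have hZ0 : ∀ s, 0 ≤ Z s := fun s => integral_nonneg fun x => sq_nonneg _
  -- the slice inequality `Φ(s) ≤ 2 Λ⁺(s) Z(s)` on `[0, T']`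
  have hu : ∀ s ∈ Icc 0 T', ContDiff ℝ ∞ (u s) := fun s hs => hsolc.contDiff_velocity hs
  obtain ⟨B₀, hB₀⟩ := linfty_bound_of_hasBoundedSobolevNormsOn_holds
    (fun s hs => (hu s hs).of_le (by norm_cast)) hB
  obtain ⟨B₁, -, hB₁⟩ := exists_forall_norm_iteratedFDeriv_le_bkmClass hu hB 1
  obtain ⟨C₁, hC₁⟩ := hB 1
  obtain ⟨C₂, hC₂⟩ := hB 2
  obtain ⟨C₃, hC₃⟩ := hB 3
  have hslice : ∀ s ∈ Icc 0 T', Φ s ≤ 2 * Λp s * Z s := by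
    intro s hs
    have h1 : ∀ x, ‖fderiv ℝ (u s) x‖ ≤ B₁ := fun x => by
      rw [← norm_iteratedFDeriv_one]; exact hB₁ s hs x
    obtain ⟨iZ, iF, -, -, iS⟩ := sliceIntegrable_of_sqIntegrable (hu s hs) (hB₀ s hs) h1
      (integrable_sq_norm_of_lintegral_le
        (ContDiff.continuous_iteratedFDeriv (m := 1) (by simp) (hu s hs)) (hC₁ s hs))
      (integrable_sq_norm_of_lintegral_le
        (ContDiff.continuous_iteratedFDeriv (m := 2) (by norm_cast) (hu s hs)) (hC₂ s hs))
      (integrable_sq_norm_of_lintegral_le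
        (ContDiff.continuous_iteratedFDeriv (m := 3) (by norm_cast) (hu s hs)) (hC₃ s hs))
    have h := stretching_sub_dissipation_le_of_admissibleRate (hu s hs) h1 iZ iF iS
      (hadm s ⟨hs.1, hs.2.trans_lt hT'T⟩)
    have hΛle : Λ s * Z s ≤ Λp s * Z s := mul_le_mul_of_nonneg_right (le_max_left _ _) (hZ0 s)
    simp only [hΦdef]
    linarith
  -- a bound `Zsup` for `Z` on `[0, T']`
  obtain ⟨Zsup, hZsup⟩ := isCompact_Icc.exists_bound_of_continuousOn hZcont
  have hZle : ∀ s ∈ Icc 0 T', Z s ≤ Zsup := fun s hs =>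
    (le_abs_self _).trans ((Real.norm_eq_abs _).symm.le.trans (hZsup s hs))
  -- integrability of `2 Λ⁺ Z` on `(0, b)` and the integral inequality `Z(b) ≤ Z(0) + ∫₀ᵇ 2Λ⁺Z`
  have hprod : ∀ b ∈ Ioc 0 T', IntegrableOn (fun s => 2 * Λp s * Z s) (Ioo 0 b) := by
    intro b hb
    have hsub : Ioo 0 b ⊆ Ico 0 T := fun s hs => ⟨hs.1.le, hs.2.trans (hb.2.trans_lt hT'T)⟩
    have hg : IntegrableOn (fun s => 2 * Λp s) (Ioo 0 b) := (hΛpint.mono_set hsub).const_mul 2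
    have hZm : AEStronglyMeasurable Z (volume.restrict (Ioo 0 b)) :=
      (hZcont.mono fun s hs => ⟨hs.1.le, hs.2.le.trans hb.2⟩).aestronglyMeasurable measurableSet_Ioo
    have h := hg.bdd_mul hZm (c := Zsup) ((ae_restrict_iff' measurableSet_Ioo).2
      (Eventually.of_forall fun s hs => by
        rw [Real.norm_of_nonneg (hZ0 s)]; exact hZle s ⟨hs.1.le, hs.2.le.trans hb.2⟩))
    exact (show IntegrableOn (fun s => Z s * (2 * Λp s)) (Ioo 0 b) volume from h).congr_fun
      (fun s _ => by ring) measurableSet_Ioo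
  have hint : ∀ b ∈ Ioc 0 T', Z b ≤ Z 0 + ∫ s in Ioo 0 b, 2 * Λp s * Z s := by
    intro b hb
    have h := hZeq b hb
    have hΦb : IntegrableOn Φ (Ioo 0 b) := hΦint.mono_set (Ioo_subset_Ioo_right hb.2)
    have hle : ∫ s in Ioo 0 b, Φ s ≤ ∫ s in Ioo 0 b, 2 * Λp s * Z s :=
      setIntegral_mono_on hΦb (hprod b hb) measurableSet_Ioo fun s hs =>
        hslice s ⟨hs.1.le, hs.2.le.trans hb.2⟩
    have e : ∫ s in (0 : ℝ)..b, Φ s = ∫ s in Ioo 0 b, Φ s := by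
      rw [intervalIntegral.integral_of_le hb.1.le, integral_Ioc_eq_integral_Ioo]
    simp only [hZdef] at h ⊢
    rw [h, e]
    linarith
  -- Grönwall in `ℝ≥0∞`
  have hφM : ∀ s ∈ Icc 0 T', ENNReal.ofReal (Z s) ≤ ENNReal.ofReal Zsup := fun s hs =>
    ENNReal.ofReal_le_ofReal (hZle s hs)
  have ha_fin : ∫⁻ s in Ioo 0 T', ENNReal.ofReal (2 * Λp s) ≠ ⊤ := by
    have hg : IntegrableOn (fun s => 2 * Λp s) (Ioo 0 T') :=
      (hΛpint.mono_set fun s hs => ⟨hs.1.le, hs.2.trans hT'T⟩).const_mul 2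
    rw [← ofReal_integral_eq_lintegral_ofReal hg ((ae_restrict_iff' measurableSet_Ioo).2
      (Eventually.of_forall fun s _ => by positivity))]
    exact ENNReal.ofReal_ne_top
  have hφ : ∀ s ∈ Icc 0 T', ENNReal.ofReal (Z s) ≤ ENNReal.ofReal (Z 0) +
      ∫⁻ r in Ioo 0 s, ENNReal.ofReal (2 * Λp r) * ENNReal.ofReal (Z r) := by
    intro s hs
    rcases hs.1.eq_or_lt with h0 | hs0
    · rw [← h0]; simp
    have hI := hint s ⟨hs0, hs.2⟩
    have hnn : 0 ≤ᵐ[volume.restrict (Ioo 0 s)] fun r => 2 * Λp r * Z r :=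
      Eventually.of_forall fun r => by have := hΛp0 r; have := hZ0 r; positivity
    calc ENNReal.ofReal (Z s) ≤ ENNReal.ofReal (Z 0 + ∫ r in Ioo 0 s, 2 * Λp r * Z r) :=
          ENNReal.ofReal_le_ofReal hI
      _ ≤ ENNReal.ofReal (Z 0) + ENNReal.ofReal (∫ r in Ioo 0 s, 2 * Λp r * Z r) :=
          ENNReal.ofReal_add_le
      _ = ENNReal.ofReal (Z 0) + ∫⁻ r in Ioo 0 s, ENNReal.ofReal (2 * Λp r * Z r) := by
          rw [ofReal_integral_eq_lintegral_ofReal (hprod s ⟨hs0, hs.2⟩) hnn]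
      _ = ENNReal.ofReal (Z 0) + ∫⁻ r in Ioo 0 s, ENNReal.ofReal (2 * Λp r) * ENNReal.ofReal (Z r) := by
          congr 1
          refine lintegral_congr fun r => ?_
          rw [ENNReal.ofReal_mul (by have := hΛp0 r; positivity)]
  have hG := lintegral_gronwall_le (S := T') (φ := fun s => ENNReal.ofReal (Z s))
    (a := fun s => ENNReal.ofReal (2 * Λp s)) (B := ENNReal.ofReal (Z 0))
    (M := ENNReal.ofReal Zsup) ENNReal.ofReal_ne_top ENNReal.ofReal_ne_top hφM ha_fin hφ t
    ⟨ht.1, htT'⟩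
  -- back to `ℝ`
  have hsubT : Ioo 0 t ⊆ Ico 0 T := fun s hs => ⟨hs.1.le, hs.2.trans ht.2⟩
  have hgt : IntegrableOn (fun s => 2 * Λp s) (Ioo 0 t) := (hΛpint.mono_set hsubT).const_mul 2
  have hnn2 : 0 ≤ᵐ[volume.restrict (Ioo 0 t)] fun s => 2 * Λp s :=
    Eventually.of_forall fun s => by have := hΛp0 s; positivity
  have hexp : (∫⁻ s in Ioo 0 t, ENNReal.ofReal (2 * Λp s)).toReal ≤ 2 * ∫ s in Ico 0 T, Λp s := by
    rw [← ofReal_integral_eq_lintegral_ofReal hgt hnn2, ENNReal.toReal_ofReal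
      (setIntegral_nonneg measurableSet_Ioo fun s _ => by have := hΛp0 s; positivity),
      integral_const_mul]
    refine mul_le_mul_of_nonneg_left ?_ (by norm_num)
    exact setIntegral_mono_set hΛpint ((ae_restrict_iff' measurableSet_Ico).2
      (Eventually.of_forall fun s _ => hΛp0 s)) (Eventually.of_forall hsubT)
  have hfinal : ENNReal.ofReal (Z t) ≤ ENNReal.ofReal (Z 0 * Real.exp (2 * ∫ s in Ico 0 T, Λp s)) := by
    refine hG.trans ?_
    rw [← ENNReal.ofReal_mul (hZ0 0)]
    exact ENNReal.ofReal_le_ofReal (mul_le_mul_of_nonneg_left (Real.exp_le_exp.2 hexp) (hZ0 0))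
  exact (ENNReal.ofReal_le_ofReal_iff (by have := hZ0 0; positivity)).1 hfinal

end DssBinding

open DssBinding

/-- **`BindingCriterion` — the Λ-lemma of route StretchingWellBinding (stmt-NavierStokesRegularity-1577).**
For a classical solution of unforced Navier–Stokes (`ν > 0`) on `ℝ³ × [0, T)`, Leray–Hopf from a
rapidly decaying datum: an admissible rate `Λ` (`∫ α₊(t)|ψ|² − ν∫|∇ψ|²_F ≤ Λ(t)∫|ψ|²` for all smooth
compactly supported `ψ`, all `t ∈ [0, T)`) which is integrable on `[0, T)` forces a classical
extension past `T`. Proof: the enstrophy stays bounded (`enstrophy_le_of_admissibleRate`), hence so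
does the `H¹` norm (energy inequality, `‖∇u‖₂ ≤ ‖ω‖₂`), contradicting the `H¹` blow-up rate
`cν³ ≤ ‖u(t)‖⁴_{H¹}(T − t)` of a non-extendable solution (`RungReynoldsOne.stub_h1BlowupRate`).
[this file] -/
theorem stretchingWellBinding_bindingCriterion_proof : Theses.StretchingWellBinding.BindingCriterion := by
  intro ν T hν hT u p hsol hLH hdec Λ hadm hΛ
  by_contra hnot
  obtain ⟨c, hc, hrate⟩ := stub_h1BlowupRate
  have hR := hrate hν hT hsol hLH hdec hnot
  -- the uniform bounds
  set Zmax : ℝ := (∫ x, ‖curl (u 0) x‖ ^ 2) * Real.exp (2 * ∫ s in Ico 0 T, max (Λ s) 0) with hZmax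
  have hZmax0 : 0 ≤ Zmax := mul_nonneg (integral_nonneg fun x => sq_nonneg _) (Real.exp_pos _).le
  set E₀ : ℝ≥0∞ := ENNReal.ofReal (2 * VectorCalculus.kineticEnergy (u 0)) with hE₀
  set K : ℝ≥0∞ := E₀ + ENNReal.ofReal Zmax with hK
  have hKtop : K ≠ ⊤ := ENNReal.add_ne_top.2 ⟨ENNReal.ofReal_ne_top, ENNReal.ofReal_ne_top⟩
  have hbound : ∀ t ∈ Ico 0 T,
      (∫⁻ x, ‖u t x‖ₑ ^ 2) + ∫⁻ x, ENNReal.ofReal (frobeniusNormSq (fderiv ℝ (u t) x)) ≤ K := by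
    intro t ht
    have hE : ∫⁻ x, ‖u t x‖ₑ ^ 2 ≤ E₀ := hLH.lintegral_enorm_sq_le hν.le ⟨ht.1, ht.2.le⟩
    have hZ := enstrophy_le_of_admissibleRate hν hT hsol hLH hdec hadm hΛ ht
    have hu2 : ContDiff ℝ 2 (u t) := (hsol.contDiff_velocity ht).of_le (by norm_cast)
    have hD : ∫⁻ x, ENNReal.ofReal (frobeniusNormSq (fderiv ℝ (u t) x)) ≤ ∫⁻ x, ‖curl (u t) x‖ₑ ^ 2 :=
      lintegral_frobeniusNormSq_fderiv_le_lintegral_sq_norm_curl hu2 (hsol.divFree t ht)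
        (hE.trans_lt ENNReal.ofReal_lt_top)
    -- `∫⁻ ‖curl u(t)‖ₑ² = ofReal (Z t)`
    have hω : ContDiff ℝ ∞ (curl (u t)) := contDiff_curl_smooth (hsol.contDiff_velocity ht)
    have T'pos : 0 < (t + T) / 2 := by linarith [ht.1]
    have T'lt : (t + T) / 2 < T := by linarith [ht.2]
    obtain ⟨q, hsolc, hB, -, -⟩ := stub_taoCover hν hT hsol hLH hdec ⟨T'pos, T'lt⟩
    obtain ⟨C₁, hC₁⟩ := hB 1
    have htc : t ∈ Icc 0 ((t + T) / 2) := ⟨ht.1, by linarith [ht.2]⟩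
    have iZ : Integrable fun x => ‖curl (u t) x‖ ^ 2 := by
      have i1 := integrable_sq_norm_of_lintegral_le
        (ContDiff.continuous_iteratedFDeriv (m := 1) (by simp) (hsol.contDiff_velocity ht)) (hC₁ t htc)
      refine (i1.const_mul (‖curlCLM‖ ^ 2)).mono' ((hω.continuous.norm).pow 2).aestronglyMeasurable
        (Eventually.of_forall fun x => ?_)
      rw [Real.norm_of_nonneg (sq_nonneg _), ← mul_pow]
      exact pow_le_pow_left₀ (norm_nonneg _) (norm_curl_le_norm_iteratedFDeriv_one (u t) x) 2
    have hZeq : ∫⁻ x, ‖curl (u t) x‖ₑ ^ 2 = ENNReal.ofReal (∫ x, ‖curl (u t) x‖ ^ 2) := by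
      rw [ofReal_integral_eq_lintegral_ofReal iZ (Eventually.of_forall fun x => sq_nonneg _)]
      refine lintegral_congr fun x => ?_
      rw [← ofReal_norm, ← ENNReal.ofReal_pow (norm_nonneg _)]
    calc (∫⁻ x, ‖u t x‖ₑ ^ 2) + ∫⁻ x, ENNReal.ofReal (frobeniusNormSq (fderiv ℝ (u t) x))
        ≤ E₀ + ∫⁻ x, ‖curl (u t) x‖ₑ ^ 2 := add_le_add hE hD
      _ ≤ E₀ + ENNReal.ofReal Zmax := by
          rw [hZeq]; exact add_le_add le_rfl (ENNReal.ofReal_le_ofReal hZ)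
  -- choose `t` close to `T`
  set k : ℝ := K.toReal with hk
  have hk0 : 0 ≤ k := ENNReal.toReal_nonneg
  set δ : ℝ := min T (c * ν ^ 3 / (2 * (k ^ 2 + 1))) with hδ
  have hcν : 0 < c * ν ^ 3 := by positivity
  have hδ0 : 0 < δ := lt_min hT (by positivity)
  have hδT : δ ≤ T := min_le_left _ _
  have hδc : k ^ 2 * δ < c * ν ^ 3 := by
    have h1 : δ ≤ c * ν ^ 3 / (2 * (k ^ 2 + 1)) := min_le_right _ _
    have h2 : k ^ 2 * δ ≤ k ^ 2 * (c * ν ^ 3 / (2 * (k ^ 2 + 1))) :=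
      mul_le_mul_of_nonneg_left h1 (sq_nonneg _)
    have h3 : k ^ 2 * (c * ν ^ 3 / (2 * (k ^ 2 + 1))) < c * ν ^ 3 := by
      rw [mul_div_assoc', div_lt_iff₀ (by positivity)]
      nlinarith [sq_nonneg k]
    linarith
  have htI : T - δ ∈ Ico 0 T := ⟨by linarith, by linarith⟩
  have h := hR (T - δ) htI
  have hKk : K = ENNReal.ofReal k := by rw [hk, ENNReal.ofReal_toReal hKtop]
  have hsq : ((∫⁻ x, ‖u (T - δ) x‖ₑ ^ 2) + ∫⁻ x, ENNReal.ofReal (frobeniusNormSq (fderiv ℝ (u (T - δ)) x))) ^ 2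
      ≤ K ^ 2 := by
    have hb := hbound (T - δ) htI
    rw [pow_two, pow_two]; exact mul_le_mul' hb hb
  have hlt : K ^ 2 * ENNReal.ofReal (T - (T - δ)) < ENNReal.ofReal (c * ν ^ 3) := by
    rw [sub_sub_cancel, hKk, ← ENNReal.ofReal_pow hk0, ← ENNReal.ofReal_mul (sq_nonneg _)]
    exact (ENNReal.ofReal_lt_ofReal_iff hcν).2 hδc
  have hge : ENNReal.ofReal (c * ν ^ 3) ≤ K ^ 2 * ENNReal.ofReal (T - (T - δ)) :=
    h.trans (mul_le_mul' hsq le_rfl)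
  exact absurd (hge.trans_lt hlt) (lt_irrefl _)

end Summit.NavierStokesRegularity.NavierStokesRegularity.Theorems

end
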